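import Mathlib.Computability.Halting
import Literature.ModelTheory.ProofTheory.GodelCoding

/-!
# The arithmetised proof checker: certificates, rules, computability

Support file for the proof of the enumerability theorem
(`FirstOrder.Language.Theory.IsComputablyAxiomatizable.isRE`; Enderton, *A Mathematical
Introduction to Logic*, §2.5 Enumerability Theorem, §3.4–3.5, Thm. 35I "`#A` recursive ⇒
`#Cn A` r.e."). This file contains the *purely combinatorial* half of the arithmetisation: the
certificate format, the rule table, the checker, and the proof that the checker is computable
(relative to three oracles) so that "some certificate is accepted" is an r.e. predicate
(`rePred_exists_check`). What the judgements *mean*, and that the checker is sound and complete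
for the Hilbert calculus of `HilbertCalculus.lean` and for Mathlib's Gödel numbering, is proved in
`CheckerSoundness.lean` / `CheckerCompleteness.lean`.

## Format

* A *judgement* is a single natural `Jn kind a b c d = ⟪kind, a, b, c, d⟫` (`Nat.pair`-tuple);
  its components are read back by `jK, jA, jB, jC, jD`. There are 13 kinds (lift / instance /
  closedness / freshness judgements about the numeric codes of `GodelCoding.lean`, derivability
  `kind 8`, the three judgements `9, 10, 11` tying pre-syntax to Mathlib terms, argument tuples and
  bounded formulas with their Gödel letters, and `kind 12`: "the sentence with Gödel number `n` is
  a theorem").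
* A *line* is a list of naturals `[j, p₁, …, pₖ, x₁, …]`: the judgement `j` it establishes, the
  judgements `pᵢ` it uses as premises — referenced **by value**: a premise is admissible iff it is
  the judgement of an *earlier* line — and extra parameters `xᵢ`.
* A *rule* (`Rule`) is a number of premises together with a list of equations between terms of a
  tiny expression language `Tm` (field access, constants, pairing/unpairing, `+ - *`, comparisons,
  and four operations on `Encodable`-coded lists of naturals). `Tm.eval` is primitive recursive
  once and for all (`Tm.primrec_eval`), so the whole rule table costs nothing on the
  computability side. Three rules additionally consult an oracle: the arity tables
  `arF arR : ℕ → Option ℕ` of the function/relation symbol codes and the membership test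
  `memA : ℕ → Bool` of the axiom set.
* A *certificate* is a list of lines; `certOK` checks every line against the judgements of the
  lines before it; `check n c` accepts iff moreover the judgement `Jn 12 n 0 0 0` occurs.

## Main statements

* `Tm.primrec_eval`, `computable_lineOK`, `computable_check` [folklore];
* `rePred_exists_check`: `{n | ∃ c, check n c}` is r.e. when the oracles are computable
  (unbounded search, Mathlib `Partrec.rfind`). [folklore]

## References

* H. B. Enderton, *A Mathematical Introduction to Logic*, Academic Press (1972), §3.4
  (arithmetization of syntax: items 1–20), §3.5 Thm. 35I.
-/

namespace Literature.ModelTheory.ProofTheory.PreFOL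

open Encodable Denumerable

/-! ### Judgement numerals -/

/-- The judgement numeral `⟪k, a, b, c, d⟫`. [folklore] -/
def Jn (k a b c d : ℕ) : ℕ := Nat.pair k (Nat.pair a (Nat.pair b (Nat.pair c d)))

/-- Kind of a judgement numeral. [folklore] -/
def jK (n : ℕ) : ℕ := n.unpair.1
/-- First component of a judgement numeral. [folklore] -/
def jA (n : ℕ) : ℕ := n.unpair.2.unpair.1
/-- Second component of a judgement numeral. [folklore] -/
def jB (n : ℕ) : ℕ := n.unpair.2.unpair.2.unpair.1
/-- Third component of a judgement numeral. [folklore] -/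
def jC (n : ℕ) : ℕ := n.unpair.2.unpair.2.unpair.2.unpair.1
/-- Fourth component of a judgement numeral. [folklore] -/
def jD (n : ℕ) : ℕ := n.unpair.2.unpair.2.unpair.2.unpair.2

/-- Reading back the kind. [folklore] -/
@[simp] theorem jK_Jn (k a b c d : ℕ) : jK (Jn k a b c d) = k := by simp [jK, Jn]
/-- Reading back the first component. [folklore] -/
@[simp] theorem jA_Jn (k a b c d : ℕ) : jA (Jn k a b c d) = a := by simp [jA, Jn]
/-- Reading back the second component. [folklore] -/
@[simp] theorem jB_Jn (k a b c d : ℕ) : jB (Jn k a b c d) = b := by simp [jB, Jn]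
/-- Reading back the third component. [folklore] -/
@[simp] theorem jC_Jn (k a b c d : ℕ) : jC (Jn k a b c d) = c := by simp [jC, Jn]
/-- Reading back the fourth component. [folklore] -/
@[simp] theorem jD_Jn (k a b c d : ℕ) : jD (Jn k a b c d) = d := by simp [jD, Jn]

/-- A judgement numeral is determined by its components. [folklore] -/
theorem Jn_inj {k a b c d k' a' b' c' d' : ℕ} :
    Jn k a b c d = Jn k' a' b' c' d' ↔ k = k' ∧ a = a' ∧ b = b' ∧ c = c' ∧ d = d' := by
  simp [Jn]

/-! ### The expression language of rule side conditions -/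

/-- Terms of the expression language in which the side conditions of the checker's rules are
written; they are evaluated over a line (`List ℕ`, read with `List.getI`, default `0`).
`lcons`, `lappend`, `lmapArg`, `lflat` act on `Encodable`-codes of lists of naturals:
`lmapArg k e` maps the letter transformation `x ↦ 2 ⟪k, x⟫` (argument letters of an atomic
formula) over the coded list `e`, and `lflat E` decodes every entry of the coded list `E` as a
coded list and concatenates. [folklore] -/
inductive Tm : Type
  | fld (i : ℕ)
  | cst (n : ℕ)
  | pair (a b : Tm)
  | left (a : Tm)
  | right (a : Tm)
  | add (a b : Tm)
  | sub (a b : Tm)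
  | mul (a b : Tm)
  | iteLt (a b t e : Tm)
  | iteEq (a b t e : Tm)
  | lcons (a b : Tm)
  | lappend (a b : Tm)
  | lmapArg (k a : Tm)
  | lflat (a : Tm)

namespace Tm

/-- Evaluation of an expression over a line. [folklore] -/
def eval (v : List ℕ) : Tm → ℕ
  | fld i => v.getI i
  | cst n => n
  | pair a b => Nat.pair (a.eval v) (b.eval v)
  | left a => (a.eval v).unpair.1
  | right a => (a.eval v).unpair.2
  | add a b => a.eval v + b.eval v
  | sub a b => a.eval v - b.eval v
  | mul a b => a.eval v * b.eval v
  | iteLt a b t e => if a.eval v < b.eval v then t.eval v else e.eval v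
  | iteEq a b t e => if a.eval v = b.eval v then t.eval v else e.eval v
  | lcons a b => encode (a.eval v :: ofNat (List ℕ) (b.eval v))
  | lappend a b => encode (ofNat (List ℕ) (a.eval v) ++ ofNat (List ℕ) (b.eval v))
  | lmapArg k a => encode ((ofNat (List ℕ) (a.eval v)).map fun e => 2 * Nat.pair (k.eval v) e)
  | lflat a => encode ((ofNat (List ℕ) (a.eval v)).map (ofNat (List ℕ))).flatten

/-- **Evaluation of expressions is primitive recursive** (uniformly in the line, for each fixed
expression). [folklore] -/
theorem primrec_eval : ∀ t : Tm, Primrec fun v : List ℕ => t.eval v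
  | fld i => by simpa [eval] using Primrec.list_getI.comp Primrec.id (Primrec.const i)
  | cst n => by simpa [eval] using Primrec.const n
  | pair a b => by simpa [eval] using Primrec₂.natPair.comp (primrec_eval a) (primrec_eval b)
  | left a => by simpa [eval] using Primrec.fst.comp (Primrec.unpair.comp (primrec_eval a))
  | right a => by simpa [eval] using Primrec.snd.comp (Primrec.unpair.comp (primrec_eval a))
  | add a b => by simpa [eval] using Primrec.nat_add.comp (primrec_eval a) (primrec_eval b)
  | sub a b => by simpa [eval] using Primrec.nat_sub.comp (primrec_eval a) (primrec_eval b)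
  | mul a b => by simpa [eval] using Primrec.nat_mul.comp (primrec_eval a) (primrec_eval b)
  | iteLt a b t e => by
      simpa [eval] using Primrec.ite (Primrec.nat_lt.comp (primrec_eval a) (primrec_eval b))
        (primrec_eval t) (primrec_eval e)
  | iteEq a b t e => by
      simpa [eval] using Primrec.ite (Primrec.eq.comp (primrec_eval a) (primrec_eval b))
        (primrec_eval t) (primrec_eval e)
  | lcons a b => by
      simpa [eval] using Primrec.encode.comp (Primrec.list_cons.comp (primrec_eval a)
        ((Primrec.ofNat (List ℕ)).comp (primrec_eval b)))
  | lappend a b => by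
      simpa [eval] using Primrec.encode.comp (Primrec.list_append.comp
        ((Primrec.ofNat (List ℕ)).comp (primrec_eval a))
        ((Primrec.ofNat (List ℕ)).comp (primrec_eval b)))
  | lmapArg k a => by
      have h : Primrec₂ fun (v : List ℕ) (e : ℕ) => 2 * Nat.pair (k.eval v) e :=
        Primrec.nat_mul.comp (Primrec.const 2)
          (Primrec₂.natPair.comp ((primrec_eval k).comp Primrec.fst) Primrec.snd)
      simpa [eval] using Primrec.encode.comp
        (Primrec.list_map ((Primrec.ofNat (List ℕ)).comp (primrec_eval a)) h)
  | lflat a => by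
      have h : Primrec₂ fun (_ : List ℕ) (e : ℕ) => ofNat (List ℕ) e :=
        (Primrec.ofNat (List ℕ)).comp Primrec.snd
      simpa [eval] using Primrec.encode.comp (Primrec.list_flatten.comp
        (Primrec.list_map ((Primrec.ofNat (List ℕ)).comp (primrec_eval a)) h))

/-! Derived expressions: judgement numerals, their projections, and the numeric constructors of
`GodelCoding.lean`. -/

/-- Expression for a judgement numeral. [folklore] -/
def jn (k : ℕ) (a b c d : Tm) : Tm := pair (cst k) (pair a (pair b (pair c d)))
/-- Expression for the kind of a judgement. [folklore] -/
def kd (p : Tm) : Tm := left p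
/-- Expression for the first component of a judgement. [folklore] -/
def p1 (p : Tm) : Tm := left (right p)
/-- Expression for the second component of a judgement. [folklore] -/
def p2 (p : Tm) : Tm := left (right (right p))
/-- Expression for the third component of a judgement. [folklore] -/
def p3 (p : Tm) : Tm := left (right (right (right p)))
/-- Expression for the fourth component of a judgement. [folklore] -/
def p4 (p : Tm) : Tm := right (right (right (right p)))
/-- Expression for `varC`. [folklore] -/
def varT (i : Tm) : Tm := add (mul (cst 4) i) (cst 1)
/-- Expression for `paramC`. [folklore] -/
def paramT (c : Tm) : Tm := add (mul (cst 4) c) (cst 2)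
/-- Expression for `funcC`. [folklore] -/
def funcT (f a : Tm) : Tm := add (mul (cst 4) (pair f a)) (cst 3)
/-- Expression for `consC`. [folklore] -/
def consT (t r : Tm) : Tm := add (mul (cst 4) (pair t r)) (cst 4)
/-- Expression for `equalC`. [folklore] -/
def equalT (a b : Tm) : Tm := add (mul (cst 4) (pair a b)) (cst 1)
/-- Expression for `relC`. [folklore] -/
def relT (r a : Tm) : Tm := add (mul (cst 4) (pair r a)) (cst 2)
/-- Expression for `impC`. [folklore] -/
def impT (a b : Tm) : Tm := add (mul (cst 4) (pair a b)) (cst 3)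
/-- Expression for `allC`. [folklore] -/
def allT (a : Tm) : Tm := add (mul (cst 4) a) (cst 4)
/-- Expression for the code `encode [a]` of a singleton list. [folklore] -/
def lsing (a : Tm) : Tm := lcons a (cst 0)

variable (v : List ℕ)

/-- Evaluation of `jn`. [folklore] -/
@[simp] theorem eval_jn (k : ℕ) (a b c d : Tm) :
    (jn k a b c d).eval v = Jn k (a.eval v) (b.eval v) (c.eval v) (d.eval v) := rfl
/-- Evaluation of `kd`. [folklore] -/
@[simp] theorem eval_kd (p : Tm) : (kd p).eval v = jK (p.eval v) := rfl
/-- Evaluation of `p1`. [folklore] -/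
@[simp] theorem eval_p1 (p : Tm) : (p1 p).eval v = jA (p.eval v) := rfl
/-- Evaluation of `p2`. [folklore] -/
@[simp] theorem eval_p2 (p : Tm) : (p2 p).eval v = jB (p.eval v) := rfl
/-- Evaluation of `p3`. [folklore] -/
@[simp] theorem eval_p3 (p : Tm) : (p3 p).eval v = jC (p.eval v) := rfl
/-- Evaluation of `p4`. [folklore] -/
@[simp] theorem eval_p4 (p : Tm) : (p4 p).eval v = jD (p.eval v) := rfl
/-- Evaluation of `varT`. [folklore] -/
@[simp] theorem eval_varT (i : Tm) : (varT i).eval v = varC (i.eval v) := rfl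
/-- Evaluation of `paramT`. [folklore] -/
@[simp] theorem eval_paramT (c : Tm) : (paramT c).eval v = paramC (c.eval v) := rfl
/-- Evaluation of `funcT`. [folklore] -/
@[simp] theorem eval_funcT (f a : Tm) : (funcT f a).eval v = funcC (f.eval v) (a.eval v) := rfl
/-- Evaluation of `consT`. [folklore] -/
@[simp] theorem eval_consT (t r : Tm) : (consT t r).eval v = consC (t.eval v) (r.eval v) := rfl
/-- Evaluation of `equalT`. [folklore] -/
@[simp] theorem eval_equalT (a b : Tm) : (equalT a b).eval v = equalC (a.eval v) (b.eval v) := rfl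
/-- Evaluation of `relT`. [folklore] -/
@[simp] theorem eval_relT (r a : Tm) : (relT r a).eval v = relC (r.eval v) (a.eval v) := rfl
/-- Evaluation of `impT`. [folklore] -/
@[simp] theorem eval_impT (a b : Tm) : (impT a b).eval v = impC (a.eval v) (b.eval v) := rfl
/-- Evaluation of `allT`. [folklore] -/
@[simp] theorem eval_allT (a : Tm) : (allT a).eval v = allC (a.eval v) := rfl
/-- Evaluation of `lsing`. [folklore] -/
@[simp] theorem eval_lsing (a : Tm) : (lsing a).eval v = encode [a.eval v] := by
  simp [lsing, eval]
/-- Evaluation of a field. [folklore] -/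
@[simp] theorem eval_fld (i : ℕ) : (fld i).eval v = v.getI i := rfl
/-- Evaluation of a constant. [folklore] -/
@[simp] theorem eval_cst (n : ℕ) : (cst n).eval v = n := rfl
/-- Evaluation of a sum. [folklore] -/
@[simp] theorem eval_add (a b : Tm) : (add a b).eval v = a.eval v + b.eval v := rfl
/-- Evaluation of a difference. [folklore] -/
@[simp] theorem eval_sub (a b : Tm) : (sub a b).eval v = a.eval v - b.eval v := rfl
/-- Evaluation of a product. [folklore] -/
@[simp] theorem eval_mul (a b : Tm) : (mul a b).eval v = a.eval v * b.eval v := rfl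
/-- Evaluation of a pair. [folklore] -/
@[simp] theorem eval_pair (a b : Tm) : (pair a b).eval v = Nat.pair (a.eval v) (b.eval v) := rfl
/-- Evaluation of a comparison. [folklore] -/
@[simp] theorem eval_iteLt (a b t e : Tm) :
    (iteLt a b t e).eval v = if a.eval v < b.eval v then t.eval v else e.eval v := rfl
/-- Evaluation of an equality test. [folklore] -/
@[simp] theorem eval_iteEq (a b t e : Tm) :
    (iteEq a b t e).eval v = if a.eval v = b.eval v then t.eval v else e.eval v := rfl
/-- Evaluation of `lcons`. [folklore] -/
@[simp] theorem eval_lcons (a b : Tm) :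
    (lcons a b).eval v = encode (a.eval v :: ofNat (List ℕ) (b.eval v)) := rfl
/-- Evaluation of `lappend`. [folklore] -/
@[simp] theorem eval_lappend (a b : Tm) :
    (lappend a b).eval v = encode (ofNat (List ℕ) (a.eval v) ++ ofNat (List ℕ) (b.eval v)) := rfl
/-- Evaluation of `lmapArg`. [folklore] -/
@[simp] theorem eval_lmapArg (k a : Tm) : (lmapArg k a).eval v =
    encode ((ofNat (List ℕ) (a.eval v)).map fun e => 2 * Nat.pair (k.eval v) e) := rfl
/-- Evaluation of `lflat`. [folklore] -/
@[simp] theorem eval_lflat (a : Tm) :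
    (lflat a).eval v = encode ((ofNat (List ℕ) (a.eval v)).map (ofNat (List ℕ))).flatten := rfl

end Tm

/-! ### Rules and the line check -/

/-- A rule of the checker: the number of premises (fields `1, …, nprems` of the line must be
judgements of earlier lines) and the side conditions, a list of equations between expressions
evaluated over the line. [folklore] -/
structure Rule where
  /-- number of premises -/
  nprems : ℕ
  /-- side conditions -/
  eqs : List (Tm × Tm)

/-- All equations of the list hold on the line. [folklore] -/
def eqsOK (line : List ℕ) : List (Tm × Tm) → Bool
  | [] => true
  | e :: es => (e.1.eval line == e.2.eval line) && eqsOK line es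

/-- The fields `1, …, n` of the line occur among the earlier judgements `prev`. [folklore] -/
def premsOK (prev line : List ℕ) : ℕ → Bool
  | 0 => true
  | n + 1 => premsOK prev line n && decide (line.getI (n + 1) ∈ prev)

/-- A line passes a rule (given the earlier judgements). [folklore] -/
def Rule.ok (r : Rule) (prev line : List ℕ) : Bool :=
  premsOK prev line r.nprems && eqsOK line r.eqs

/-- A line passes one of a list of rules. [folklore] -/
def anyOK (prev line : List ℕ) : List Rule → Bool
  | [] => false
  | r :: rs => r.ok prev line || anyOK prev line rs

/-- `eqsOK` unfolds to a conjunction. [folklore] -/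
theorem eqsOK_iff (line : List ℕ) : ∀ es : List (Tm × Tm),
    eqsOK line es = true ↔ ∀ e ∈ es, e.1.eval line = e.2.eval line
  | [] => by simp [eqsOK]
  | e :: es => by simp [eqsOK, eqsOK_iff line es]

/-- `premsOK` unfolds to a conjunction. [folklore] -/
theorem premsOK_iff (prev line : List ℕ) : ∀ n : ℕ,
    premsOK prev line n = true ↔ ∀ i, 1 ≤ i → i ≤ n → line.getI i ∈ prev
  | 0 => by simp [premsOK]; intro i h1 h2; omega
  | n + 1 => by
      rw [premsOK, Bool.and_eq_true, premsOK_iff prev line n, decide_eq_true_iff]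
      constructor
      · rintro ⟨h, hn⟩ i h1 h2
        rcases Nat.lt_or_ge i (n + 1) with h3 | h3
        · exact h i h1 (by omega)
        · have : i = n + 1 := by omega
          subst this; exact hn
      · intro h
        exact ⟨fun i h1 h2 => h i h1 (by omega), h (n + 1) (by omega) le_rfl⟩

/-- `anyOK` unfolds to a disjunction. [folklore] -/
theorem anyOK_iff (prev line : List ℕ) : ∀ rs : List Rule,
    anyOK prev line rs = true ↔ ∃ r ∈ rs, r.ok prev line = true
  | [] => by simp [anyOK]
  | r :: rs => by simp [anyOK, anyOK_iff prev line rs]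

/-- `premsOK` is monotone in the earlier judgements. [folklore] -/
theorem premsOK_mono {prev prev' line : List ℕ} (h : prev ⊆ prev') {n : ℕ}
    (hn : premsOK prev line n = true) : premsOK prev' line n = true := by
  rw [premsOK_iff] at hn ⊢
  exact fun i h1 h2 => h (hn i h1 h2)

/-- `Rule.ok` is monotone in the earlier judgements. [folklore] -/
theorem Rule.ok_mono (r : Rule) {prev prev' line : List ℕ} (h : prev ⊆ prev')
    (hr : r.ok prev line = true) : r.ok prev' line = true := by
  simp only [Rule.ok, Bool.and_eq_true] at hr ⊢
  exact ⟨premsOK_mono h hr.1, hr.2⟩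

/-- `anyOK` is monotone in the earlier judgements. [folklore] -/
theorem anyOK_mono {prev prev' line : List ℕ} (h : prev ⊆ prev') {rs : List Rule}
    (hr : anyOK prev line rs = true) : anyOK prev' line rs = true := by
  rw [anyOK_iff] at hr ⊢
  obtain ⟨r, hm, hr⟩ := hr
  exact ⟨r, hm, r.ok_mono h hr⟩

/-! ### Primitive recursiveness of the line check -/

/-- `eqsOK` is primitive recursive in the line. [folklore] -/
theorem primrec_eqsOK : ∀ es : List (Tm × Tm), Primrec fun line : List ℕ => eqsOK line es
  | [] => by simpa [eqsOK] using Primrec.const true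
  | e :: es => by
      simpa [eqsOK] using Primrec.and.comp
        (Primrec.beq.comp (Tm.primrec_eval e.1) (Tm.primrec_eval e.2)) (primrec_eqsOK es)

/-- Membership of a natural in a list of naturals is a primitive recursive relation. [folklore] -/
theorem primrecRel_mem : PrimrecRel fun (x : ℕ) (l : List ℕ) => x ∈ l :=
  (PrimrecRel.exists_mem_list (R := fun a b : ℕ => a = b) Primrec.eq).swap.of_eq
    fun x l => by simp [Function.swap]

/-- `premsOK` is primitive recursive. [folklore] -/
theorem primrec_premsOK : ∀ n : ℕ, Primrec₂ fun prev line : List ℕ => premsOK prev line n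
  | 0 => by simpa [premsOK] using (Primrec₂.const true)
  | n + 1 => by
      have h := (primrecRel_mem.comp
        (Primrec.list_getI.comp Primrec.snd (Primrec.const (n + 1))) Primrec.fst).decide
      have := Primrec.and.comp (primrec_premsOK n) h
      simpa [premsOK, Primrec₂] using this

/-- `Rule.ok` is primitive recursive. [folklore] -/
theorem Rule.primrec_ok (r : Rule) : Primrec₂ r.ok := by
  unfold Rule.ok
  exact Primrec.and.comp (primrec_premsOK r.nprems) ((primrec_eqsOK r.eqs).comp Primrec.snd)

/-- `anyOK` is primitive recursive. [folklore] -/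
theorem primrec_anyOK : ∀ rs : List Rule, Primrec₂ fun prev line : List ℕ => anyOK prev line rs
  | [] => by simpa [anyOK] using (Primrec₂.const false)
  | r :: rs => by
      have := Primrec.or.comp r.primrec_ok (primrec_anyOK rs)
      simpa [anyOK, Primrec₂] using this

/-! ### The rule table

Kinds: `0` lift of terms `⟪0, m, x, y, _⟫`, `1` lift of formulas, `2` instance of terms
`⟪2, m, s, x, y⟫`, `3` instance of formulas, `4` closed, `5` closed term, `6` freshness of a
parameter for terms `⟪6, c, x, _, _⟫`, `7` freshness for formulas, `8` derivable `⟪8, x, _, _, _⟫`,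
`9` Mathlib term `⟪9, k, x, e, _⟫`, `10` Mathlib argument tuple `⟪10, k, n, x, E⟫`, `11` Mathlib
bounded formula `⟪11, k, x, e, _⟫`, `12` theorem `⟪12, n, _, _, _⟫`; see `CheckerSoundness.lean`
for their meaning. Line layout: field `0` is the judgement, fields `1 … nprems` the premises,
later fields extra parameters. -/

namespace Rules

open Tm

/-- field `i` of the line -/
local notation "#" i => Tm.fld i

/-- lift/var: `⟪0, m, var i, (i < m ? var i : var (i+1))⟫`; line `[j, m, i]`. [folklore] -/
def ltVar : Rule := ⟨0, [(#0, jn 0 (#1) (varT (#2))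
  (iteLt (#2) (#1) (varT (#2)) (varT (add (#2) (cst 1)))) (cst 0))]⟩
/-- lift/param; line `[j, m, c]`. [folklore] -/
def ltParam : Rule := ⟨0, [(#0, jn 0 (#1) (paramT (#2)) (paramT (#2)) (cst 0))]⟩
/-- lift/func from lift of the arguments; line `[j, p, f]`. [folklore] -/
def ltFunc : Rule := ⟨1, [(kd (#1), cst 0),
  (#0, jn 0 (p1 (#1)) (funcT (#2) (p2 (#1))) (funcT (#2) (p3 (#1))) (cst 0))]⟩
/-- lift/nil; line `[j, m]`. [folklore] -/
def ltNil : Rule := ⟨0, [(#0, jn 0 (#1) (cst 0) (cst 0) (cst 0))]⟩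
/-- lift/cons; line `[j, p, q]`. [folklore] -/
def ltCons : Rule := ⟨2, [(kd (#1), cst 0), (kd (#2), cst 0), (p1 (#2), p1 (#1)),
  (#0, jn 0 (p1 (#1)) (consT (p2 (#1)) (p2 (#2))) (consT (p3 (#1)) (p3 (#2))) (cst 0))]⟩
/-- lift/falsum; line `[j, m]`. [folklore] -/
def lfFalsum : Rule := ⟨0, [(#0, jn 1 (#1) (cst 0) (cst 0) (cst 0))]⟩
/-- lift/equal; line `[j, p, q]`. [folklore] -/
def lfEqual : Rule := ⟨2, [(kd (#1), cst 0), (kd (#2), cst 0), (p1 (#2), p1 (#1)),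
  (#0, jn 1 (p1 (#1)) (equalT (p2 (#1)) (p2 (#2))) (equalT (p3 (#1)) (p3 (#2))) (cst 0))]⟩
/-- lift/rel; line `[j, p, r]`. [folklore] -/
def lfRel : Rule := ⟨1, [(kd (#1), cst 0),
  (#0, jn 1 (p1 (#1)) (relT (#2) (p2 (#1))) (relT (#2) (p3 (#1))) (cst 0))]⟩
/-- lift/imp; line `[j, p, q]`. [folklore] -/
def lfImp : Rule := ⟨2, [(kd (#1), cst 1), (kd (#2), cst 1), (p1 (#2), p1 (#1)),
  (#0, jn 1 (p1 (#1)) (impT (p2 (#1)) (p2 (#2))) (impT (p3 (#1)) (p3 (#2))) (cst 0))]⟩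
/-- lift/all; line `[j, p]`. [folklore] -/
def lfAll : Rule := ⟨1, [(kd (#1), cst 1),
  (#0, jn 1 (p1 (#1)) (allT (p2 (#1))) (allT (p3 (#1))) (cst 0))]⟩
/-- instance/var; line `[j, m, s, i]`. [folklore] -/
def itVar : Rule := ⟨0, [(#0, jn 2 (#1) (#2) (varT (#3))
  (iteLt (#3) (#1) (varT (#3)) (iteEq (#3) (#1) (#2) (varT (sub (#3) (cst 1))))))]⟩
/-- instance/param; line `[j, m, s, c]`. [folklore] -/
def itParam : Rule := ⟨0, [(#0, jn 2 (#1) (#2) (paramT (#3)) (paramT (#3)))]⟩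
/-- instance/func; line `[j, p, f]`. [folklore] -/
def itFunc : Rule := ⟨1, [(kd (#1), cst 2),
  (#0, jn 2 (p1 (#1)) (p2 (#1)) (funcT (#2) (p3 (#1))) (funcT (#2) (p4 (#1))))]⟩
/-- instance/nil; line `[j, m, s]`. [folklore] -/
def itNil : Rule := ⟨0, [(#0, jn 2 (#1) (#2) (cst 0) (cst 0))]⟩
/-- instance/cons; line `[j, p, q]`. [folklore] -/
def itCons : Rule := ⟨2, [(kd (#1), cst 2), (kd (#2), cst 2), (p1 (#2), p1 (#1)), (p2 (#2), p2 (#1)),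
  (#0, jn 2 (p1 (#1)) (p2 (#1)) (consT (p3 (#1)) (p3 (#2))) (consT (p4 (#1)) (p4 (#2))))]⟩
/-- instance/falsum; line `[j, m, s]`. [folklore] -/
def ifFalsum : Rule := ⟨0, [(#0, jn 3 (#1) (#2) (cst 0) (cst 0))]⟩
/-- instance/equal; line `[j, p, q]`. [folklore] -/
def ifEqual : Rule := ⟨2, [(kd (#1), cst 2), (kd (#2), cst 2), (p1 (#2), p1 (#1)), (p2 (#2), p2 (#1)),
  (#0, jn 3 (p1 (#1)) (p2 (#1)) (equalT (p3 (#1)) (p3 (#2))) (equalT (p4 (#1)) (p4 (#2))))]⟩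
/-- instance/rel; line `[j, p, r]`. [folklore] -/
def ifRel : Rule := ⟨1, [(kd (#1), cst 2),
  (#0, jn 3 (p1 (#1)) (p2 (#1)) (relT (#2) (p3 (#1))) (relT (#2) (p4 (#1))))]⟩
/-- instance/imp; line `[j, p, q]`. [folklore] -/
def ifImp : Rule := ⟨2, [(kd (#1), cst 3), (kd (#2), cst 3), (p1 (#2), p1 (#1)), (p2 (#2), p2 (#1)),
  (#0, jn 3 (p1 (#1)) (p2 (#1)) (impT (p3 (#1)) (p3 (#2))) (impT (p4 (#1)) (p4 (#2))))]⟩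
/-- instance/all; line `[j, p]`. [folklore] -/
def ifAll : Rule := ⟨1, [(kd (#1), cst 3),
  (#0, jn 3 (p1 (#1)) (p2 (#1)) (allT (p3 (#1))) (allT (p4 (#1))))]⟩
/-- closed/param; line `[j, c]`. [folklore] -/
def clParam : Rule := ⟨0, [(#0, jn 4 (paramT (#1)) (cst 0) (cst 0) (cst 0))]⟩
/-- closed/func; line `[j, p, f]`. [folklore] -/
def clFunc : Rule := ⟨1, [(kd (#1), cst 4),
  (#0, jn 4 (funcT (#2) (p1 (#1))) (cst 0) (cst 0) (cst 0))]⟩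
/-- closed/nil; line `[j]`. [folklore] -/
def clNil : Rule := ⟨0, [(#0, jn 4 (cst 0) (cst 0) (cst 0) (cst 0))]⟩
/-- closed/cons; line `[j, p, q]`. [folklore] -/
def clCons : Rule := ⟨2, [(kd (#1), cst 4), (kd (#2), cst 4),
  (#0, jn 4 (consT (p1 (#1)) (p1 (#2))) (cst 0) (cst 0) (cst 0))]⟩
/-- closed term/param; line `[j, c]`. [folklore] -/
def ctParam : Rule := ⟨0, [(#0, jn 5 (paramT (#1)) (cst 0) (cst 0) (cst 0))]⟩
/-- closed term/func; line `[j, p, f]`. [folklore] -/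
def ctFunc : Rule := ⟨1, [(kd (#1), cst 4),
  (#0, jn 5 (funcT (#2) (p1 (#1))) (cst 0) (cst 0) (cst 0))]⟩
/-- fresh/var; line `[j, c, i]`. [folklore] -/
def ntVar : Rule := ⟨0, [(#0, jn 6 (#1) (varT (#2)) (cst 0) (cst 0))]⟩
/-- fresh/param (`c ≠ c'`); line `[j, c, c']`. [folklore] -/
def ntParam : Rule := ⟨0, [(iteEq (#1) (#2) (cst 1) (cst 0), cst 0),
  (#0, jn 6 (#1) (paramT (#2)) (cst 0) (cst 0))]⟩
/-- fresh/func; line `[j, p, f]`. [folklore] -/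
def ntFunc : Rule := ⟨1, [(kd (#1), cst 6),
  (#0, jn 6 (p1 (#1)) (funcT (#2) (p2 (#1))) (cst 0) (cst 0))]⟩
/-- fresh/nil; line `[j, c]`. [folklore] -/
def ntNil : Rule := ⟨0, [(#0, jn 6 (#1) (cst 0) (cst 0) (cst 0))]⟩
/-- fresh/cons; line `[j, p, q]`. [folklore] -/
def ntCons : Rule := ⟨2, [(kd (#1), cst 6), (kd (#2), cst 6), (p1 (#2), p1 (#1)),
  (#0, jn 6 (p1 (#1)) (consT (p2 (#1)) (p2 (#2))) (cst 0) (cst 0))]⟩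
/-- fresh/falsum; line `[j, c]`. [folklore] -/
def nfFalsum : Rule := ⟨0, [(#0, jn 7 (#1) (cst 0) (cst 0) (cst 0))]⟩
/-- fresh/equal; line `[j, p, q]`. [folklore] -/
def nfEqual : Rule := ⟨2, [(kd (#1), cst 6), (kd (#2), cst 6), (p1 (#2), p1 (#1)),
  (#0, jn 7 (p1 (#1)) (equalT (p2 (#1)) (p2 (#2))) (cst 0) (cst 0))]⟩
/-- fresh/rel; line `[j, p, r]`. [folklore] -/
def nfRel : Rule := ⟨1, [(kd (#1), cst 6),
  (#0, jn 7 (p1 (#1)) (relT (#2) (p2 (#1))) (cst 0) (cst 0))]⟩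
/-- fresh/imp; line `[j, p, q]`. [folklore] -/
def nfImp : Rule := ⟨2, [(kd (#1), cst 7), (kd (#2), cst 7), (p1 (#2), p1 (#1)),
  (#0, jn 7 (p1 (#1)) (impT (p2 (#1)) (p2 (#2))) (cst 0) (cst 0))]⟩
/-- fresh/all; line `[j, p]`. [folklore] -/
def nfAll : Rule := ⟨1, [(kd (#1), cst 7),
  (#0, jn 7 (p1 (#1)) (allT (p2 (#1))) (cst 0) (cst 0))]⟩
/-- derivable/P1 `φ → ψ → φ`; line `[j, a, b]`. [folklore] -/
def pfP1 : Rule := ⟨0, [(#0, jn 8 (impT (#1) (impT (#2) (#1))) (cst 0) (cst 0) (cst 0))]⟩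
/-- derivable/P2 `(φ → ψ → χ) → (φ → ψ) → φ → χ`; line `[j, a, b, c]`. [folklore] -/
def pfP2 : Rule := ⟨0, [(#0, jn 8 (impT (impT (#1) (impT (#2) (#3)))
  (impT (impT (#1) (#2)) (impT (#1) (#3)))) (cst 0) (cst 0) (cst 0))]⟩
/-- derivable/P3 `¬¬φ → φ`; line `[j, a]`. [folklore] -/
def pfP3 : Rule := ⟨0, [(#0, jn 8 (impT (impT (impT (#1) (cst 0)) (cst 0)) (#1))
  (cst 0) (cst 0) (cst 0))]⟩
/-- derivable/Q1 `∀φ → φ[s]` (`s` a closed term); line `[j, p, q]`, `p` an instance judgement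
at level `0`, `q` closedness of `s`. [folklore] -/
def pfQ1 : Rule := ⟨2, [(kd (#1), cst 3), (p1 (#1), cst 0), (kd (#2), cst 5), (p1 (#2), p2 (#1)),
  (#0, jn 8 (impT (allT (p3 (#1))) (p4 (#1))) (cst 0) (cst 0) (cst 0))]⟩
/-- derivable/Q2 `∀(φ → ψ) → ∀φ → ∀ψ`; line `[j, a, b]`. [folklore] -/
def pfQ2 : Rule := ⟨0, [(#0, jn 8 (impT (allT (impT (#1) (#2))) (impT (allT (#1)) (allT (#2))))
  (cst 0) (cst 0) (cst 0))]⟩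
/-- derivable/Q3 `φ → ∀φ↑`; line `[j, p]`, `p` a lift judgement at level `0`. [folklore] -/
def pfQ3 : Rule := ⟨1, [(kd (#1), cst 1), (p1 (#1), cst 0),
  (#0, jn 8 (impT (p2 (#1)) (allT (p3 (#1)))) (cst 0) (cst 0) (cst 0))]⟩
/-- derivable/E1 `t = t`; line `[j, t]`. [folklore] -/
def pfE1 : Rule := ⟨0, [(#0, jn 8 (equalT (#1) (#1)) (cst 0) (cst 0) (cst 0))]⟩
/-- derivable/E2 `s = t → φ[s] → φ[t]`; line `[j, p, q, u, w]`: instances `p, q` of the same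
formula at `s`, `t`, closedness `u, w` of `s, t`. [folklore] -/
def pfE2 : Rule := ⟨4, [(kd (#1), cst 3), (p1 (#1), cst 0), (kd (#2), cst 3), (p1 (#2), cst 0),
  (p3 (#2), p3 (#1)), (kd (#3), cst 5), (p1 (#3), p2 (#1)), (kd (#4), cst 5), (p1 (#4), p2 (#2)),
  (#0, jn 8 (impT (equalT (p2 (#1)) (p2 (#2))) (impT (p4 (#1)) (p4 (#2))))
    (cst 0) (cst 0) (cst 0))]⟩
/-- derivable/modus ponens; line `[j, p, q, x]` with `p : φ → x`, `q : φ`. [folklore] -/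
def pfMP : Rule := ⟨2, [(kd (#1), cst 8), (kd (#2), cst 8), (p1 (#1), impT (p1 (#2)) (#3)),
  (#0, jn 8 (#3) (cst 0) (cst 0) (cst 0))]⟩
/-- derivable/generalisation on a fresh constant; line `[j, p, q, u, c]`: `p : φ[c]`,
`q` the instance judgement `φ[c]`, `u` freshness of `c` for `φ`. [folklore] -/
def pfGen : Rule := ⟨3, [(kd (#1), cst 8), (kd (#2), cst 3), (p1 (#2), cst 0),
  (p2 (#2), paramT (#4)), (p4 (#2), p1 (#1)), (kd (#3), cst 7), (p1 (#3), #4), (p2 (#3), p3 (#2)),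
  (#0, jn 8 (allT (p3 (#2))) (cst 0) (cst 0) (cst 0))]⟩
/-- derivable/hypothesis (oracle rule: the Gödel number `jC p` must be an axiom); line `[j, p]`,
`p` a Mathlib-formula judgement at depth `0`. [folklore] -/
def pfHyp : Rule := ⟨1, [(kd (#1), cst 11), (p1 (#1), cst 0),
  (#0, jn 8 (p2 (#1)) (cst 0) (cst 0) (cst 0))]⟩
/-- Mathlib term/variable `i < k`; line `[j, k, i]`. [folklore] -/
def mtVar : Rule := ⟨0, [(iteLt (#2) (#1) (cst 1) (cst 0), cst 1),
  (#0, jn 9 (#1) (varT (#2)) (lsing (add (mul (cst 4) (#2)) (cst 2))) (cst 0))]⟩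
/-- Mathlib term/application (oracle rule: `f` must be a function code of arity `jB p`);
line `[j, p, f]`, `p` an argument-tuple judgement. [folklore] -/
def mtFunc : Rule := ⟨1, [(kd (#1), cst 10),
  (#0, jn 9 (p1 (#1)) (funcT (#2) (p3 (#1)))
    (lcons (add (mul (cst 2) (#2)) (cst 1)) (lflat (p4 (#1)))) (cst 0))]⟩
/-- Mathlib argument tuple/empty; line `[j, k]`. [folklore] -/
def maNil : Rule := ⟨0, [(#0, jn 10 (#1) (cst 0) (cst 0) (cst 0))]⟩
/-- Mathlib argument tuple/cons; line `[j, p, q]`, `p` a term judgement, `q` a tuple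
judgement. [folklore] -/
def maCons : Rule := ⟨2, [(kd (#1), cst 9), (kd (#2), cst 10), (p1 (#2), p1 (#1)),
  (#0, jn 10 (p1 (#1)) (add (p2 (#2)) (cst 1)) (consT (p2 (#1)) (p3 (#2)))
    (lcons (p3 (#1)) (p4 (#2))))]⟩
/-- Mathlib formula/falsum; line `[j, k]`. [folklore] -/
def mlFalsum : Rule := ⟨0, [(#0, jn 11 (#1) (cst 0) (lsing (add (mul (cst 4) (#1)) (cst 11))) (cst 0))]⟩
/-- Mathlib formula/equal; line `[j, p, q]`, `p, q` term judgements. [folklore] -/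
def mlEqual : Rule := ⟨2, [(kd (#1), cst 9), (kd (#2), cst 9), (p1 (#2), p1 (#1)),
  (#0, jn 11 (p1 (#1)) (equalT (p2 (#1)) (p2 (#2)))
    (lcons (mul (cst 2) (pair (p1 (#1)) (p3 (#1))))
      (lsing (mul (cst 2) (pair (p1 (#1)) (p3 (#2)))))) (cst 0))]⟩
/-- Mathlib formula/atomic relation (oracle rule: `r` must be a relation code of arity `jB p`);
line `[j, p, r]`, `p` an argument-tuple judgement. [folklore] -/
def mlRel : Rule := ⟨1, [(kd (#1), cst 10),
  (#0, jn 11 (p1 (#1)) (relT (#2) (p3 (#1)))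
    (lcons (add (mul (cst 4) (#2)) (cst 1)) (lcons (add (mul (cst 4) (p1 (#1))) (cst 3))
      (lmapArg (p1 (#1)) (p4 (#1))))) (cst 0))]⟩
/-- Mathlib formula/imp; line `[j, p, q]`. [folklore] -/
def mlImp : Rule := ⟨2, [(kd (#1), cst 11), (kd (#2), cst 11), (p1 (#2), p1 (#1)),
  (#0, jn 11 (p1 (#1)) (impT (p2 (#1)) (p2 (#2))) (lcons (cst 3) (lappend (p3 (#1)) (p3 (#2))))
    (cst 0))]⟩
/-- Mathlib formula/all; line `[j, p, k]`, `p` a formula judgement at depth `k + 1`. [folklore] -/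
def mlAll : Rule := ⟨1, [(kd (#1), cst 11), (p1 (#1), add (#2) (cst 1)),
  (#0, jn 11 (#2) (allT (p2 (#1))) (lcons (cst 7) (p3 (#1))) (cst 0))]⟩
/-- theorem: a derivable pre-sentence that translates the sentence with Gödel number `n`;
line `[j, p, q]`, `p` derivability, `q` a Mathlib-formula judgement at depth `0`. [folklore] -/
def thm : Rule := ⟨2, [(kd (#1), cst 8), (kd (#2), cst 11), (p1 (#2), cst 0), (p2 (#2), p1 (#1)),
  (#0, jn 12 (p3 (#2)) (cst 0) (cst 0) (cst 0))]⟩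

/-- The rules without oracle conditions. [folklore] -/
def pure : List Rule :=
  [ltVar, ltParam, ltFunc, ltNil, ltCons, lfFalsum, lfEqual, lfRel, lfImp, lfAll,
   itVar, itParam, itFunc, itNil, itCons, ifFalsum, ifEqual, ifRel, ifImp, ifAll,
   clParam, clFunc, clNil, clCons, ctParam, ctFunc,
   ntVar, ntParam, ntFunc, ntNil, ntCons, nfFalsum, nfEqual, nfRel, nfImp, nfAll,
   pfP1, pfP2, pfP3, pfQ1, pfQ2, pfQ3, pfE1, pfE2, pfMP, pfGen,
   mtVar, maNil, maCons, mlFalsum, mlEqual, mlImp, mlAll, thm]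

end Rules

/-! ### The checker -/

section Checker

variable (arF arR : ℕ → Option ℕ) (memA : ℕ → Bool)

/-- A line is accepted, given the judgements `prev` of the earlier lines: it passes a pure rule,
or one of the three oracle rules together with its oracle condition (arity of the function /
relation symbol code in field `2`, resp. axiomhood of the Gödel number carried by the premise).
[folklore] -/
def lineOK (prev line : List ℕ) : Bool :=
  anyOK prev line Rules.pure
  || (Rules.mtFunc.ok prev line && decide (arF (line.getI 2) = some (jB (line.getI 1))))
  || (Rules.mlRel.ok prev line && decide (arR (line.getI 2) = some (jB (line.getI 1))))
  || (Rules.pfHyp.ok prev line && memA (jC (line.getI 1)))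

/-- The judgements of a list of lines. [folklore] -/
def heads (c : List (List ℕ)) : List ℕ := c.map fun l => l.getI 0

/-- A certificate is accepted iff every line is accepted given the judgements of the lines before
it. (Written as a primitive recursion on the length, the form in which it is proved computable.)
[folklore] -/
def certOK (c : List (List ℕ)) : Bool :=
  Nat.rec (motive := fun _ => Bool) true
    (fun i b => b && lineOK arF arR memA (heads (c.take i)) (c.getI i)) c.length

/-- `check n c`: the certificate `c` is accepted and establishes the judgement `⟪12, n, 0, 0, 0⟫`
("the sentence with Gödel number `n` is a theorem"). [folklore] -/
def check (n : ℕ) (c : List (List ℕ)) : Bool :=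
  certOK arF arR memA c && decide (Jn 12 n 0 0 0 ∈ heads c)

variable {arF arR memA}

/-- `heads` of an extended certificate. [folklore] -/
@[simp] theorem heads_append (c c' : List (List ℕ)) : heads (c ++ c') = heads c ++ heads c' := by
  simp [heads]

/-- `heads` of a one-line certificate. [folklore] -/
@[simp] theorem heads_singleton (l : List ℕ) : heads [l] = [l.getI 0] := by simp [heads]

/-- `heads` of the empty certificate. [folklore] -/
@[simp] theorem heads_nil : heads [] = [] := by simp [heads]

/-- The empty certificate is accepted. [folklore] -/
@[simp] theorem certOK_nil : certOK arF arR memA [] = true := rfl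

/-- The recursion computing `certOK` only reads the first `i` lines. [folklore] -/
theorem certOK_rec_append (c c' : List (List ℕ)) : ∀ i ≤ c.length,
    Nat.rec (motive := fun _ => Bool) true
      (fun i b => b && lineOK arF arR memA (heads ((c ++ c').take i)) ((c ++ c').getI i)) i =
    Nat.rec (motive := fun _ => Bool) true
      (fun i b => b && lineOK arF arR memA (heads (c.take i)) (c.getI i)) i
  | 0, _ => rfl
  | i + 1, hi => by
      simp only
      rw [certOK_rec_append c c' i (Nat.le_of_succ_le hi),
        List.take_append_of_le_length (Nat.le_of_succ_le hi), List.getI_append _ _ _ hi]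

/-- Accepting a certificate extended by one line. [folklore] -/
theorem certOK_append_singleton (c : List (List ℕ)) (l : List ℕ) :
    certOK arF arR memA (c ++ [l]) = (certOK arF arR memA c && lineOK arF arR memA (heads c) l) := by
  unfold certOK
  rw [List.length_append, List.length_singleton]
  simp only
  rw [certOK_rec_append c [l] c.length le_rfl, List.take_left', List.getI_append_right _ _ _ le_rfl]
  · simp
  · rfl

/-- Every line of an accepted certificate is accepted given the judgements before it. [folklore] -/
theorem certOK_iff_forall (c : List (List ℕ)) :
    certOK arF arR memA c = true ↔
      ∀ i < c.length, lineOK arF arR memA (heads (c.take i)) (c.getI i) = true := by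
  induction c using List.reverseRecOn with
  | nil => simp
  | append_singleton c l ih =>
      rw [certOK_append_singleton, Bool.and_eq_true, ih, List.length_append, List.length_singleton]
      constructor
      · rintro ⟨h, hl⟩ i hi
        rcases Nat.lt_or_ge i c.length with h' | h'
        · rw [List.take_append_of_le_length h'.le, List.getI_append _ _ _ h']
          exact h i h'
        · have : i = c.length := by omega
          subst this
          rw [List.take_left', List.getI_append_right _ _ _ le_rfl]
          · simpa using hl
          · rfl
      · intro h
        refine ⟨fun i hi => ?_, ?_⟩
        · have := h i (by omega)
          rwa [List.take_append_of_le_length hi.le, List.getI_append _ _ _ hi] at this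
        · have := h c.length (by omega)
          rw [List.take_left', List.getI_append_right _ _ _ le_rfl] at this
          · simpa using this
          · rfl

/-! ### Computability -/

/-- **The line check is computable** (relative to the oracles): the pure part is primitive
recursive by `Tm.primrec_eval`, the oracle conditions are single oracle calls. [folklore] -/
theorem computable_lineOK (hF : Computable arF) (hR : Computable arR) (hA : Computable memA) :
    Computable₂ (lineOK arF arR memA) := by
  unfold lineOK
  have h1 : Computable₂ fun prev line : List ℕ => anyOK prev line Rules.pure :=
    (primrec_anyOK Rules.pure).to_comp
  have hg1 : Computable fun p : List ℕ × List ℕ => p.2.getI 1 :=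
    (Primrec.list_getI.comp Primrec.snd (Primrec.const 1)).to_comp
  have hg2 : Computable fun p : List ℕ × List ℕ => p.2.getI 2 :=
    (Primrec.list_getI.comp Primrec.snd (Primrec.const 2)).to_comp
  have hjB : Computable jB :=
    (Primrec.fst.comp (Primrec.unpair.comp (Primrec.snd.comp (Primrec.unpair.comp
      (Primrec.snd.comp (Primrec.unpair.comp Primrec.id)))))).to_comp
  have hjC : Computable jC :=
    (Primrec.fst.comp (Primrec.unpair.comp (Primrec.snd.comp (Primrec.unpair.comp
      (Primrec.snd.comp (Primrec.unpair.comp (Primrec.snd.comp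
        (Primrec.unpair.comp Primrec.id)))))))).to_comp
  have h2 : Computable fun p : List ℕ × List ℕ =>
      Rules.mtFunc.ok p.1 p.2 && decide (arF (p.2.getI 2) = some (jB (p.2.getI 1))) :=
    (Primrec.and.to_comp).comp Rules.mtFunc.primrec_ok.to_comp
      ((Primrec.eq (α := Option ℕ)).decide.to_comp.comp (hF.comp hg2)
        (Computable.option_some.comp (hjB.comp hg1)))
  have h3 : Computable fun p : List ℕ × List ℕ =>
      Rules.mlRel.ok p.1 p.2 && decide (arR (p.2.getI 2) = some (jB (p.2.getI 1))) :=
    (Primrec.and.to_comp).comp Rules.mlRel.primrec_ok.to_comp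
      ((Primrec.eq (α := Option ℕ)).decide.to_comp.comp (hR.comp hg2)
        (Computable.option_some.comp (hjB.comp hg1)))
  have h4 : Computable fun p : List ℕ × List ℕ =>
      Rules.pfHyp.ok p.1 p.2 && memA (jC (p.2.getI 1)) :=
    (Primrec.and.to_comp).comp Rules.pfHyp.primrec_ok.to_comp (hA.comp (hjC.comp hg1))
  exact (Primrec.or.to_comp).comp ((Primrec.or.to_comp).comp ((Primrec.or.to_comp).comp h1 h2) h3) h4

/-- `heads` is primitive recursive. [folklore] -/
theorem primrec_heads : Primrec heads :=
  Primrec.list_map Primrec.id ((Primrec.list_getI.comp Primrec.snd (Primrec.const 0)).to₂)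

/-- **The certificate check is computable** (a primitive recursion of the line check over the
length). [folklore] -/
theorem computable_certOK (hF : Computable arF) (hR : Computable arR) (hA : Computable memA) :
    Computable (certOK arF arR memA) := by
  have hh : Computable₂ fun (c : List (List ℕ)) (p : ℕ × Bool) =>
      p.2 && lineOK arF arR memA (heads (c.take p.1)) (c.getI p.1) := by
    have hprev : Computable fun q : List (List ℕ) × (ℕ × Bool) => heads (q.1.take q.2.1) :=
      (primrec_heads.comp (Primrec.list_take.comp (Primrec.fst.comp Primrec.snd) Primrec.fst)).to_comp
    have hcur : Computable fun q : List (List ℕ) × (ℕ × Bool) => q.1.getI q.2.1 :=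
      (Primrec.list_getI.comp Primrec.fst (Primrec.fst.comp Primrec.snd)).to_comp
    exact (Primrec.and.to_comp).comp (Computable.snd.comp Computable.snd)
      ((computable_lineOK hF hR hA).comp hprev hcur)
  exact (Computable.nat_rec Computable.list_length (Computable.const true) hh).of_eq fun c => rfl

/-- **The checker is computable.** [folklore] -/
theorem computable_check (hF : Computable arF) (hR : Computable arR) (hA : Computable memA) :
    Computable₂ (check arF arR memA) := by
  unfold check
  have hmem : Computable fun p : ℕ × List (List ℕ) => decide (Jn 12 p.1 0 0 0 ∈ heads p.2) := by
    have hJ : Primrec fun n : ℕ => Jn 12 n 0 0 0 := by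
      unfold Jn
      exact Primrec₂.natPair.comp (Primrec.const 12) (Primrec₂.natPair.comp Primrec.id (Primrec.const _))
    exact (primrecRel_mem.comp (hJ.comp Primrec.fst) (primrec_heads.comp Primrec.snd)).decide.to_comp
  exact (Primrec.and.to_comp).comp ((computable_certOK hF hR hA).comp Computable.snd) hmem

/-- **Theoremhood certificates form an r.e. set**: with computable oracles, the set of `n` for
which some certificate is accepted is recursively enumerable (unbounded search over the codes of
certificates, `Partrec.rfind`). [folklore] -/
theorem rePred_exists_check (hF : Computable arF) (hR : Computable arR) (hA : Computable memA) :
    REPred fun n : ℕ => ∃ c : List (List ℕ), check arF arR memA n c = true := by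
  let f : ℕ × ℕ → Bool := fun p => check arF arR memA p.1 (ofNat (List (List ℕ)) p.2)
  have hf : Computable f :=
    (computable_check hF hR hA).comp Computable.fst ((Computable.ofNat _).comp Computable.snd)
  have hp : Partrec fun n : ℕ => Nat.rfind fun m => Part.some (f (n, m)) :=
    Partrec.rfind (hf.partrec.to₂)
  refine (Partrec.dom_re hp).of_eq fun n => ?_
  simp only [Nat.rfind_dom, Part.mem_some_iff, Part.some_dom, implies_true, and_true]
  constructor
  · rintro ⟨m, hm⟩
    exact ⟨_, hm.symm⟩
  · rintro ⟨c, hc⟩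
    refine ⟨encode c, ?_⟩
    simp [f, hc]

end Checker

end Literature.ModelTheory.ProofTheory.PreFOL
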